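import Mathlib.Analysis.Calculus.MeanValue
import Mathlib.Analysis.Calculus.ContDiff.Basic
import Mathlib.Analysis.Calculus.ContDiff.Comp
import Mathlib.Analysis.Calculus.ContDiff.Operations
import Mathlib.Analysis.Calculus.ContDiff.FTaylorSeries
import Mathlib.Analysis.Calculus.Deriv.Basic
import HarnessLib

/-!
# Joint smoothness from partial derivatives

Analysis/Calculus support file (everything proved, no named facts): the classical criteria by
which **separate** regularity in the variables of a product is merged into **joint** regularity.

* `hasFDerivAt_of_partial` (**total differentiability from partial derivatives**): let
  `f : E₁ × E₂ → G` (real normed spaces). If the partial derivative `∂₁f` exists on a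
  neighbourhood of `p₀` and is continuous at `p₀` (as a map into `E₁ →L[ℝ] G`), and the partial
  derivative `∂₂f(p₀)` exists, then `f` is Fréchet differentiable at `p₀` with
  `Df(p₀)(h, k) = ∂₁f(p₀) h + ∂₂f(p₀) k` (the mean value inequality along the segment
  `[p₀.1, p₀.1 + h] × {p₀.2 + k}`; Dieudonné, *Foundations of Modern Analysis* (1960), (8.9.1);
  Rudin, *Principles*, Thm. 9.21; Lang, *Real and Functional Analysis*, XIII Thm. 7.1).
  Corollaries on an open set `U`: `hasFDerivAt_of_partial_of_isOpen`, and `C^{n+1}` regularity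
  from `Cⁿ` partial-derivative fields, `contDiffOn_succ_of_partial`.
* `contDiffOn_iteratedFDeriv_of_mixed_partials` / `contDiffOn_uncurry_of_mixed_partials`
  (**joint `C^∞` smoothness on `I × E` from the family of mixed partials**): let `I ⊆ ℝ` be open
  and `w : ℕ → ℝ → E → F` a family of space–time fields (`w (l+1)` playing the rôle of the time
  derivative of `w l`) such that every slice `w l t`, `t ∈ I`, is `C^∞` on `E`; every spatial
  derivative `t ↦ Dᵏ(w l t)(x)` has time derivative `Dᵏ(w (l+1) t)(x)`; and every
  `(t, x) ↦ Dᵏ(w l t)(x)` is jointly continuous on `I × E`. Then every `uncurry (w l)` (indeed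
  every `(t, x) ↦ Dᵏ(w l t)(x)`) is `C^∞` on `I × E` (induction on the order `n`, for all `k, l`
  simultaneously, through Mathlib's `contDiffOn_succ_iff_fderiv_of_isOpen`: the total derivative
  of `(t, x) ↦ Dᵏ(w l t)(x)` is assembled from `Dᵏ(w (l+1) ·)` and `Dᵏ⁺¹(w l ·)` by the first
  part). This is the form in which regularity theories that produce spatial smoothness of each
  time slice and time derivatives "through the equation" (heat and Navier–Stokes smoothing,
  e.g. Koch–Nadirashvili–Seregin–Šverák 2009, Prop. 4.1) deliver jointly smooth solutions.
* `continuousOn_prod_of_locally_uniform` (the joint-continuity input): `(t, x) ↦ g t x` is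
  jointly continuous on `I × Y` if each `g t` is continuous and `t ↦ g t` is continuous at every
  `t₀ ∈ I` uniformly in `x`.

## Mathlib search

Mathlib (this pin) has the mean value inequality `Convex.norm_image_sub_le_of_norm_hasFDerivWithin_le'`,
the characterisations `contDiffOn_succ_iff_fderiv_of_isOpen`, `contDiffOn_infty`,
`fderiv_iteratedFDeriv`, and derivatives of maps *into* products (`HasFDerivAt.prodMk`), but no
criterion for differentiability of maps *out of* a product from partial derivatives
(`lean search 'of_partial'`, `'partial derivatives are continuous'`: no hits in Mathlib; the tree's
`Literature/Analysis/Calculus/HadamardLemma.lean` has `partialFDerivFst` for `C¹` data, the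
converse direction).

## References

* J. Dieudonné, *Foundations of Modern Analysis*, Academic Press 1960, (8.9.1) and (8.12.x).
* W. Rudin, *Principles of Mathematical Analysis*, 3rd ed., Thm. 9.21.
* S. Lang, *Real and Functional Analysis*, 3rd ed., Ch. XIII, Thm. 7.1 and §8.
-/

open Set Function Filter Topology Asymptotics Metric
open scoped Topology ContDiff

namespace Literature.Analysis.Calculus

/-! ### Total differentiability from partial derivatives -/

section Partial

variable {E₁ E₂ G : Type*} [NormedAddCommGroup E₁] [NormedSpace ℝ E₁] [NormedAddCommGroup E₂]
  [NormedSpace ℝ E₂] [NormedAddCommGroup G] [NormedSpace ℝ G]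

/-- **Differentiability from partial derivatives.** If `∂₁f` exists near `p₀` and is continuous
at `p₀`, and `∂₂f(p₀)` exists, then `f : E₁ × E₂ → G` is Fréchet differentiable at `p₀` with
derivative `(h, k) ↦ ∂₁f(p₀) h + ∂₂f(p₀) k`. (Dieudonné (8.9.1); Rudin, Thm. 9.21.) [folklore] -/
theorem hasFDerivAt_of_partial {f : E₁ × E₂ → G} {p₀ : E₁ × E₂}
    {f₁ : E₁ × E₂ → E₁ →L[ℝ] G} {L₂ : E₂ →L[ℝ] G}
    (h₁ : ∀ᶠ p in 𝓝 p₀, HasFDerivAt (fun a => f (a, p.2)) (f₁ p) p.1)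
    (hc : ContinuousAt f₁ p₀) (h₂ : HasFDerivAt (fun b => f (p₀.1, b)) L₂ p₀.2) :
    HasFDerivAt f ((f₁ p₀).comp (ContinuousLinearMap.fst ℝ E₁ E₂) +
      L₂.comp (ContinuousLinearMap.snd ℝ E₁ E₂)) p₀ := by
  rw [hasFDerivAt_iff_isLittleO_nhds_zero, Asymptotics.isLittleO_iff]
  intro c hc0
  -- the increment in the second variable, from `h₂`
  have hB : ∀ᶠ q : E₁ × E₂ in 𝓝 0,
      ‖f (p₀.1, p₀.2 + q.2) - f (p₀.1, p₀.2) - L₂ q.2‖ ≤ c / 2 * ‖q.2‖ := by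
    have h := Asymptotics.isLittleO_iff.1 (hasFDerivAt_iff_isLittleO_nhds_zero.1 h₂) (half_pos hc0)
    have ht : Tendsto (fun q : E₁ × E₂ => q.2) (𝓝 0) (𝓝 0) := by
      simpa using (continuous_snd (X := E₁) (Y := E₂)).tendsto 0
    exact ht.eventually h
  -- a ball on which `∂₁f` exists and is `c/2`-close to `∂₁f(p₀)`
  obtain ⟨δ, hδ, hδp⟩ : ∃ δ > 0, ∀ p : E₁ × E₂, dist p p₀ < δ →
      HasFDerivAt (fun a => f (a, p.2)) (f₁ p) p.1 ∧ ‖f₁ p - f₁ p₀‖ ≤ c / 2 := by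
    have hc' : ∀ᶠ p in 𝓝 p₀, ‖f₁ p - f₁ p₀‖ ≤ c / 2 := by
      filter_upwards [hc.eventually_mem (closedBall_mem_nhds (f₁ p₀) (half_pos hc0))] with p hp
      rwa [mem_closedBall, dist_eq_norm] at hp
    obtain ⟨δ, hδ, h⟩ := Metric.eventually_nhds_iff.1 (h₁.and hc')
    exact ⟨δ, hδ, fun p hp => h hp⟩
  -- the increment in the first variable, by the mean value inequality
  have hA : ∀ q : E₁ × E₂, ‖q‖ < δ →
      ‖f (p₀.1 + q.1, p₀.2 + q.2) - f (p₀.1, p₀.2 + q.2) - f₁ p₀ q.1‖ ≤ c / 2 * ‖q.1‖ := by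
    intro q hq
    have hq2 : ‖q.2‖ < δ := (norm_snd_le q).trans_lt hq
    have hmem : ∀ a ∈ ball p₀.1 δ, dist (a, p₀.2 + q.2) p₀ < δ := by
      intro a ha
      rw [Prod.dist_eq, max_lt_iff]
      refine ⟨ha, ?_⟩
      simpa [dist_eq_norm] using hq2
    have hder : ∀ a ∈ ball p₀.1 δ, HasFDerivWithinAt (fun a => f (a, p₀.2 + q.2))
        (f₁ (a, p₀.2 + q.2)) (ball p₀.1 δ) a := fun a ha =>
      (hδp (a, p₀.2 + q.2) (hmem a ha)).1.hasFDerivWithinAt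
    have hbound : ∀ a ∈ ball p₀.1 δ, ‖f₁ (a, p₀.2 + q.2) - f₁ p₀‖ ≤ c / 2 := fun a ha =>
      (hδp (a, p₀.2 + q.2) (hmem a ha)).2
    have hx : p₀.1 ∈ ball p₀.1 δ := mem_ball_self hδ
    have hy : p₀.1 + q.1 ∈ ball p₀.1 δ := by
      rw [mem_ball, dist_eq_norm, add_sub_cancel_left]
      exact (norm_fst_le q).trans_lt hq
    have h := (convex_ball p₀.1 δ).norm_image_sub_le_of_norm_hasFDerivWithin_le' hder hbound hx hy
    simpa only [add_sub_cancel_left] using h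
  have hsmall : ∀ᶠ q : E₁ × E₂ in 𝓝 0, ‖q‖ < δ :=
    Metric.eventually_nhds_iff.2 ⟨δ, hδ, fun q hq => by simpa [dist_zero_right] using hq⟩
  filter_upwards [hB, hsmall] with q hBq hq
  have hAq := hA q hq
  have hsplit : f (p₀ + q) - f p₀ - ((f₁ p₀).comp (ContinuousLinearMap.fst ℝ E₁ E₂) +
      L₂.comp (ContinuousLinearMap.snd ℝ E₁ E₂)) q =
      (f (p₀.1 + q.1, p₀.2 + q.2) - f (p₀.1, p₀.2 + q.2) - f₁ p₀ q.1) +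
        (f (p₀.1, p₀.2 + q.2) - f (p₀.1, p₀.2) - L₂ q.2) := by
    have hpq : p₀ + q = (p₀.1 + q.1, p₀.2 + q.2) := rfl
    rw [hpq]
    simp only [add_apply, ContinuousLinearMap.comp_apply,
      ContinuousLinearMap.coe_fst', ContinuousLinearMap.coe_snd', Prod.mk.eta]
    abel
  rw [hsplit]
  calc ‖(f (p₀.1 + q.1, p₀.2 + q.2) - f (p₀.1, p₀.2 + q.2) - f₁ p₀ q.1) +
        (f (p₀.1, p₀.2 + q.2) - f (p₀.1, p₀.2) - L₂ q.2)‖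
      ≤ c / 2 * ‖q.1‖ + c / 2 * ‖q.2‖ := norm_add_le_of_le hAq hBq
    _ ≤ c / 2 * ‖q‖ + c / 2 * ‖q‖ := by
        gcongr
        exacts [norm_fst_le q, norm_snd_le q]
    _ = c * ‖q‖ := by ring

/-- On an open set `U` on which both partial-derivative fields exist and `∂₁f` is continuous,
`f` has the total derivative `(h, k) ↦ ∂₁f(p) h + ∂₂f(p) k` at every `p ∈ U`. [folklore] -/
theorem hasFDerivAt_of_partial_of_isOpen {f : E₁ × E₂ → G} {U : Set (E₁ × E₂)} (hU : IsOpen U)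
    {f₁ : E₁ × E₂ → E₁ →L[ℝ] G} {f₂ : E₁ × E₂ → E₂ →L[ℝ] G}
    (h₁ : ∀ p ∈ U, HasFDerivAt (fun a => f (a, p.2)) (f₁ p) p.1)
    (h₂ : ∀ p ∈ U, HasFDerivAt (fun b => f (p.1, b)) (f₂ p) p.2) (hc : ContinuousOn f₁ U)
    {p : E₁ × E₂} (hp : p ∈ U) :
    HasFDerivAt f ((f₁ p).comp (ContinuousLinearMap.fst ℝ E₁ E₂) +
      (f₂ p).comp (ContinuousLinearMap.snd ℝ E₁ E₂)) p :=
  hasFDerivAt_of_partial (Filter.mem_of_superset (hU.mem_nhds hp) fun q hq => h₁ q hq)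
    (hc.continuousAt (hU.mem_nhds hp)) (h₂ p hp)

/-- **`C^{n+1}` from `Cⁿ` partial derivatives** on an open set: if the partial-derivative fields
`∂₁f, ∂₂f` exist on `U` and are `Cⁿ` there, then `f` is `C^{n+1}` on `U`, with
`Df = ∂₁f ∘ pr₁ + ∂₂f ∘ pr₂`. (Dieudonné (8.12.x); Lang XIII §7.) [folklore] -/
theorem contDiffOn_succ_of_partial {f : E₁ × E₂ → G} {U : Set (E₁ × E₂)} (hU : IsOpen U)
    {f₁ : E₁ × E₂ → E₁ →L[ℝ] G} {f₂ : E₁ × E₂ → E₂ →L[ℝ] G} {n : ℕ}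
    (h₁ : ∀ p ∈ U, HasFDerivAt (fun a => f (a, p.2)) (f₁ p) p.1)
    (h₂ : ∀ p ∈ U, HasFDerivAt (fun b => f (p.1, b)) (f₂ p) p.2)
    (hc₁ : ContDiffOn ℝ n f₁ U) (hc₂ : ContDiffOn ℝ n f₂ U) :
    ContDiffOn ℝ (n + 1) f U := by
  have hd : ∀ p ∈ U, HasFDerivAt f ((f₁ p).comp (ContinuousLinearMap.fst ℝ E₁ E₂) +
      (f₂ p).comp (ContinuousLinearMap.snd ℝ E₁ E₂)) p := fun p hp =>
    hasFDerivAt_of_partial_of_isOpen hU h₁ h₂ hc₁.continuousOn hp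
  refine (contDiffOn_succ_iff_fderiv_of_isOpen (𝕜 := ℝ) (n := n) hU).2
    ⟨fun p hp => (hd p hp).differentiableAt.differentiableWithinAt,
      fun h => (WithTop.natCast_ne_top n h).elim, ?_⟩
  have heq : EqOn (fderiv ℝ f) (fun p => (f₁ p).comp (ContinuousLinearMap.fst ℝ E₁ E₂) +
      (f₂ p).comp (ContinuousLinearMap.snd ℝ E₁ E₂)) U := fun p hp => (hd p hp).fderiv
  exact ((hc₁.clm_comp contDiffOn_const).add (hc₂.clm_comp contDiffOn_const)).congr heq

end Partial

/-! ### Joint continuity from locally uniform continuity in one variable -/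

section Continuity

variable {X Y Z : Type*} [TopologicalSpace X] [TopologicalSpace Y] [PseudoMetricSpace Z]

/-- **Joint continuity from continuity in `x` and locally uniform continuity in `t`.** If every
`g t`, `t ∈ I`, is continuous and `t ↦ g t` is continuous at every `t₀ ∈ I` within `I`
uniformly in the second variable, then `(t, x) ↦ g t x` is continuous on `I × Y`. [folklore] -/
theorem continuousOn_prod_of_locally_uniform {g : X → Y → Z} {I : Set X}
    (hx : ∀ t ∈ I, Continuous (g t))
    (ht : ∀ t₀ ∈ I, ∀ ε > (0 : ℝ), ∀ᶠ t in 𝓝[I] t₀, ∀ y, dist (g t y) (g t₀ y) ≤ ε) :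
    ContinuousOn (fun p : X × Y => g p.1 p.2) (I ×ˢ univ) := by
  rintro ⟨t₀, y₀⟩ ⟨ht₀, -⟩
  rw [ContinuousWithinAt, Metric.tendsto_nhds, nhdsWithin_prod_eq, nhdsWithin_univ]
  intro ε hε
  have h1 : ∀ᶠ t in 𝓝[I] t₀, ∀ y, dist (g t y) (g t₀ y) ≤ ε / 3 := ht t₀ ht₀ (ε / 3) (by positivity)
  have h2 : ∀ᶠ y in 𝓝 y₀, dist (g t₀ y) (g t₀ y₀) < ε / 3 :=
    Metric.tendsto_nhds.1 ((hx t₀ ht₀).tendsto y₀) (ε / 3) (by positivity)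
  filter_upwards [h1.prod_mk h2] with p hp
  calc dist (g p.1 p.2) (g t₀ y₀) ≤ dist (g p.1 p.2) (g t₀ p.2) + dist (g t₀ p.2) (g t₀ y₀) :=
        dist_triangle _ _ _
    _ < ε / 3 + ε / 3 := add_lt_add_of_le_of_lt (hp.1 p.2) hp.2
    _ ≤ ε := by linarith

end Continuity

/-! ### Joint smoothness on `I × E` from the family of mixed partial derivatives -/

section Mixed

variable {E F : Type*} [NormedAddCommGroup E] [NormedSpace ℝ E] [NormedAddCommGroup F]
  [NormedSpace ℝ F]

/-- **Joint smoothness of all mixed partials.** Let `I ⊆ ℝ` be open and `w : ℕ → ℝ → E → F`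
(think `w l = ∂ₜˡ v`) be such that: every slice `w l t` (`t ∈ I`) is `C^∞`; for all `k, l`,
`t ∈ I`, `x`, the map `τ ↦ Dᵏ(w l τ)(x)` has derivative `Dᵏ(w (l+1) t)(x)` at `t`; and every
`(t, x) ↦ Dᵏ(w l t)(x)` is continuous on `I × E`. Then for every `n, k, l` the map
`(t, x) ↦ Dᵏ(w l t)(x)` is `Cⁿ` on `I × E` (induction on `n` for all `k, l` at once: its
partial derivatives are `Dᵏ(w (l+1) ·)` in `t` and, up to currying, `Dᵏ⁺¹(w l ·)` in `x`,
`fderiv_iteratedFDeriv`; apply `contDiffOn_succ_of_partial`). [folklore] -/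
theorem contDiffOn_iteratedFDeriv_of_mixed_partials {I : Set ℝ} (hI : IsOpen I)
    {w : ℕ → ℝ → E → F} (hx : ∀ l, ∀ t ∈ I, ContDiff ℝ ∞ (w l t))
    (ht : ∀ k l : ℕ, ∀ t ∈ I, ∀ x : E,
      HasDerivAt (fun τ => iteratedFDeriv ℝ k (w l τ) x) (iteratedFDeriv ℝ k (w (l + 1) t) x) t)
    (hc : ∀ k l : ℕ, ContinuousOn (fun p : ℝ × E => iteratedFDeriv ℝ k (w l p.1) p.2) (I ×ˢ univ))
    (n k l : ℕ) :
    ContDiffOn ℝ n (fun p : ℝ × E => iteratedFDeriv ℝ k (w l p.1) p.2) (I ×ˢ univ) := by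
  have hU : IsOpen (I ×ˢ (univ : Set E)) := hI.prod isOpen_univ
  induction n generalizing k l with
  | zero => exact contDiffOn_zero.2 (hc k l)
  | succ n ih =>
    -- the two partial-derivative fields of `g (t, x) = Dᵏ(w l t)(x)`
    set A : ℝ × E → ℝ →L[ℝ] (E [×k]→L[ℝ] F) := fun p =>
      (1 : ℝ →L[ℝ] ℝ).smulRight (iteratedFDeriv ℝ k (w (l + 1) p.1) p.2) with hA
    set B : ℝ × E → E →L[ℝ] (E [×k]→L[ℝ] F) := fun p =>
      fderiv ℝ (iteratedFDeriv ℝ k (w l p.1)) p.2 with hB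
    have hAd : ∀ p ∈ I ×ˢ (univ : Set E), HasFDerivAt
        (fun a : ℝ => iteratedFDeriv ℝ k (w l a) p.2) (A p) p.1 := fun p hp =>
      (ht k l p.1 hp.1 p.2).hasFDerivAt
    have hlt : ((k : ℕ∞) : WithTop ℕ∞) < ∞ := WithTop.coe_lt_coe.2 (ENat.coe_lt_top k)
    have hBd : ∀ p ∈ I ×ˢ (univ : Set E), HasFDerivAt
        (fun b : E => iteratedFDeriv ℝ k (w l p.1) b) (B p) p.2 := fun p hp =>
      ((hx l p.1 hp.1).differentiable_iteratedFDeriv (by exact_mod_cast hlt) p.2).hasFDerivAt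
    have hAc : ContDiffOn ℝ n A (I ×ˢ univ) := ContDiffOn.smulRight contDiffOn_const (ih k (l + 1))
    -- `fderiv ∘ Dᵏ = curry ∘ Dᵏ⁺¹` (`fderiv_iteratedFDeriv`), and currying is a linear isometry
    have hBc : ContDiffOn ℝ n B (I ×ˢ univ) := by
      have h := ContDiffOn.continuousLinearMap_comp (𝕜 := ℝ) (F := E [×(k + 1)]→L[ℝ] F)
        (G := E →L[ℝ] E [×k]→L[ℝ] F)
        ((continuousMultilinearCurryLeftEquiv ℝ (fun _ : Fin (k + 1) => E) F).toLinearIsometry.toContinuousLinearMap)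
        (ih (k + 1) l)
      refine h.congr fun p _ => ?_
      show fderiv ℝ (iteratedFDeriv ℝ k (w l p.1)) p.2 = _
      rw [fderiv_iteratedFDeriv]
      rfl
    exact contDiffOn_succ_of_partial (f := fun p : ℝ × E => iteratedFDeriv ℝ k (w l p.1) p.2) hU
      hAd hBd hAc hBc

/-- **Joint `C^∞` smoothness on `I × E` from the family of mixed partials.** Under the
hypotheses of `contDiffOn_iteratedFDeriv_of_mixed_partials`, every field `w l` is jointly `C^∞`
on `I × E`: `ContDiffOn ℝ ∞ (uncurry (w l)) (I ×ˢ univ)`; in particular so is `w 0`. This is how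
slice-wise spatial smoothness plus time derivatives obtained "through the equation" yield
classical space–time smoothness (e.g. KNSS 2009, Prop. 4.1). [folklore] -/
theorem contDiffOn_uncurry_of_mixed_partials {I : Set ℝ} (hI : IsOpen I)
    {w : ℕ → ℝ → E → F} (hx : ∀ l, ∀ t ∈ I, ContDiff ℝ ∞ (w l t))
    (ht : ∀ k l : ℕ, ∀ t ∈ I, ∀ x : E,
      HasDerivAt (fun τ => iteratedFDeriv ℝ k (w l τ) x) (iteratedFDeriv ℝ k (w (l + 1) t) x) t)
    (hc : ∀ k l : ℕ, ContinuousOn (fun p : ℝ × E => iteratedFDeriv ℝ k (w l p.1) p.2) (I ×ˢ univ))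
    (l : ℕ) :
    ContDiffOn ℝ ∞ (uncurry (w l)) (I ×ˢ univ) := by
  rw [contDiffOn_infty]
  intro n
  have h0 := contDiffOn_iteratedFDeriv_of_mixed_partials hI hx ht hc n 0 l
  set ev0 : (E [×0]→L[ℝ] F) →L[ℝ] F :=
    (continuousMultilinearCurryFin0 ℝ E F).toLinearIsometry.toContinuousLinearMap with hev0
  have heq : uncurry (w l) = ev0 ∘ fun p : ℝ × E => iteratedFDeriv ℝ 0 (w l p.1) p.2 := by
    funext p
    rfl
  rw [heq]
  exact ev0.contDiff.comp_contDiffOn h0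

end Mixed

end Literature.Analysis.Calculus
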